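import Summits.QuantumFields.BalabanUV.T4Continuum.Support.NE7LinkFunctionalMinimiser
import Summits.QuantumFields.BalabanUV.T4Continuum.Support.BlockAveragePushDirGauge
import Summits.QuantumFields.BalabanUV.T4Continuum.Support.NE3LandauOrbit
import Summits.QuantumFields.BalabanUV.T4Continuum.Support.NE3HessBounds
import Summits.QuantumFields.BalabanUV.T4Continuum.Support.SkeletonLattice
import Literature.MathematicalPhysics.QuantumFieldTheory.Balaban1983to89.B8Eq115GaugeFixing
import HarnessLib

/-!
# T⁴ programme, row NE7 — (161a) THE EXACT LATTICE LANDAU GAUGE, FILE 1∕2 — EXISTENCE: the TRACE link functional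
# `u ↦ Σ_{b} (1 − Re tr U^{u}(b))` attains its minimum over the unitary periodic gauges with ONE-POINT normalisation `u(0) = 1`,
# and every minimiser satisfies the lattice Landau condition `Σ_κ [S(z,κ) − S(z−e_κ,κ)] = 0` AT EVERY SITE, `S = W − Wᴴ`, `W = U^{u}`
# (`NE7LatticeLandauMinimiser`)

Cell `pub-balaban`, rung (B)+1 sub-cell t4, row NE7.  Lineage `b2b-balaban-t4-ne7-p2` (CRUX PROVER NE7 #2 = co-owner of row NE7), generation 88;
companion to (158b) `NE7GradientCurrencyLandauEL` (the gradient currency with the reaction in Euler–Lagrange form) and to the memo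
`t4/b2b-balaban-t4-ne7-p2/g88/REPFLAT-GRADIENT-LINE.md` §3 (F2)(a) ∕ §5.

WHY.  After (159) THE END at the trivial flat datum asks of B8's representative `W = U^{u₀} = e^{A₀}` the SUP currency `a₀` and the SMOOTHNESS OF
THE LANDAU REACTION `r` ((158b): `r` bounds the forward differences of `Σ_κ [S(x,κ) − S(x−e_κ,κ)]`, `S = (W − W⁻¹)∕2`).  The OWNER's N3a
`NE7LinkFunctionalMinimiser.exists_linkMinimiser` minimises the OPERATOR-norm functional `Σ‖U^u(b) − 1‖²` over gauges pinned at EVERY block corner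
(`u(M•y) = 1 ∀y`): that functional is not differentiable and that class produces lattice Coulomb spikes (memo §5: sup|∇A|·M² grows ≈ linearly in M).
THIS FILE gives the classical object instead: the minimiser of the TRACE functional `F_U(u) = Σ_{x ∈ periodBox P} Σ_κ (1 − Re tr U^{u}(x,κ))` (the lattice
Landau gauge of lattice gauge theory) over `{u : unitary, P-periodic, u(0) = 1}` EXISTS (compactness, as N3a) and satisfies its Euler–Lagrange equation
— the lattice Landau condition on the odd part of the links — at EVERY site: at the free sites by the first variation along `u_t = e^{tλ}·u`, `λ` a skew
matrix placed on one residue class, and at the pinned class by the torus divergence theorem `Σ_{x ∈ periodBox} div S = 0`.  So the reaction of (158b)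
VANISHES IDENTICALLY for this representative (`r = 0`): of REP♭ there then remain the sup letter `a₀` of THIS representative (+ its top re-gauging) and
the (1.9) input `j` (the OWNER's R1–R4).

WHAT, FILE 1∕2 ([folklore]; 0 def, 0 sorry):
* §1 `nReTr_skew_eq_zero` (if `Re tr(X·D) = 0` for every skew `X` then `D − Dᴴ = 0`), `cmod_mem_periodBox`, `cmod_eq_self_of_mem`, `cmod_add_zsmul`,
  `cmod_cmod_add`, `apply_cmod_of_periodic`, `sum_periodBox_shift_vec` (shift invariance of periodic sums, vector-valued — the torus divergence theorem).
* §2 **`exists_traceLinkMinimiser`** — the minimiser of `F_U` over `{unitary, P-periodic, u 0 = 1}` exists (every `d`, `P ≥ 1`, `U`).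
File 2∕2 (`NE7LatticeLandauEuler`): the first variation, the Euler–Lagrange equation at every site, and `exists_latticeLandauGauge`.

HONEST FRAMING (page 1): elementary (compactness + one-variable calculus + torus bookkeeping); existence and the Euler–Lagrange equation ONLY — the sup
letter `a₀` of this representative (N- and k-uniform) is NOT proved and is the crux (memo §3); nothing of Bałaban's asserted ([Balaban1985RegularSpaces]
reaches its Landau gauge by a contraction, not by minimisation); (APE) NOT proved; NE7 NOT PRINTED ∕ NOT PROVED; spine 0∕9; finite T⁴ rung (B)+1 — NOT
infinite volume, NOT mass gap, NOT Clay.  Continuum YM on T⁴ ⇐ BetaPertH ∧ nine spine estimates (0/9 proved); BetaPertH ⇐ (D1) ∧ (D4) ∧ CAP+tail;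
G-an2-4 gates asym, D1 and NE2/3/4.  No `sorry`.  PLACEMENT: our lemma, under `Summits/QuantumFields/BalabanUV/`.
-/

set_option autoImplicit false

open scoped BigOperators Matrix Matrix.Norms.L2Operator
open NormedSpace Finset

namespace Summit.QuantumFields.BalabanUV.T4Continuum.NE7LatticeLandauMinimiser

open Literature.MathematicalPhysics.QuantumFieldTheory.Balaban1983to89
open B7Prop1Explicit B7Prop2Explicit MatrixNorms UnitaryModel
open T4AveragingDeficitWall (nReTrL nReTrL_apply hasDerivAt_exp_smul_zero hasDerivAt_exp_neg_smul_zero)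
open T4AveragingDeficitWallBoundary (IsPeriodicCfg periodBox mem_periodBox)
open AveragingDeficitTorusChart (redN redN_add_smul periodic_smul_vec)
open SkeletonLattice (cdiv cmod smul_cdiv_add_cmod cmod_nonneg cmod_lt cmod_eq_of_repr)
open NE3HilbertSchmidtTorus (HSMat Sec extS resS extS_resS extS_boxVec extS_add_period)
open NE3HilbertSchmidtTorus.HSMat (toHS ofHS)
open NE7LinkFunctionalMinimiser (continuous_extS_apply norm_sq_le_one_of_unitary)
open BlockAveragePushDirGauge (expGauge expGauge_zero val_gaugeAct_expGauge gaugeAct_const_one)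
open NE3CovariantCalculus (hsR hsR_self)
open NE3LandauOrbit (eq_zero_of_nhsNormSq_eq_zero)
open NE3HessBounds (nReTr_mul_comm)
open B8Eq115GaugeFixing (gaugeAct_mul)

noncomputable section

variable {d : ℕ} {n : Type*} [Fintype n] [DecidableEq n]

/-! ## §1 Algebra and torus bookkeeping -/

/-- **If `Re tr(X·D) = 0` for every skew `X`, then `D` is Hermitian**: `D − Dᴴ = 0` (test with `X = Dᴴ − D`: `‖D − Dᴴ‖²_HS = Re tr((Dᴴ−D)D) − Re tr((Dᴴ−D)Dᴴ)`
and the second term equals minus the first by `tr Aᴴ = conj tr A` and cyclicity). [folklore] -/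
theorem nReTr_skew_eq_zero [Nonempty n] {D : Matrix n n ℂ} (h : ∀ X : Matrix n n ℂ, X ∈ skewAdjoint (Matrix n n ℂ) → nReTr (X * D) = 0) :
    D - Dᴴ = 0 := by
  have hX : Dᴴ - D ∈ skewAdjoint (Matrix n n ℂ) := by
    rw [skewAdjoint.mem_iff]
    change (Dᴴ - D)ᴴ = -(Dᴴ - D)
    rw [Matrix.conjTranspose_sub, Matrix.conjTranspose_conjTranspose, neg_sub]
  have h1 : nReTr ((Dᴴ - D) * D) = 0 := h _ hX
  have h2 : nReTr ((Dᴴ - D) * Dᴴ) = 0 := by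
    have e1 : ((Dᴴ - D) * Dᴴ) = (D * (D - Dᴴ))ᴴ := by
      rw [Matrix.conjTranspose_mul, Matrix.conjTranspose_sub, Matrix.conjTranspose_conjTranspose]
    rw [e1, nReTr_conjTranspose, nReTr_mul_comm, show (D - Dᴴ) * D = -((Dᴴ - D) * D) by noncomm_ring]
    unfold nReTr at h1 ⊢
    rw [Matrix.trace_neg, Complex.neg_re, neg_div, h1, neg_zero]
  have hsq : nhsNormSq (D - Dᴴ) = 0 := by
    rw [← hsR_self]
    unfold hsR
    rw [Matrix.conjTranspose_sub, Matrix.conjTranspose_conjTranspose, mul_sub]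
    unfold nReTr at h1 h2 ⊢
    rw [Matrix.trace_sub, Complex.sub_re, sub_div, h1, h2, sub_zero]
  exact eq_zero_of_nhsNormSq_eq_zero hsq

omit [Fintype n] [DecidableEq n] in
/-- `cmod P x ∈ periodBox P`. [folklore] -/
theorem cmod_mem_periodBox {P : ℕ} (hP : 1 ≤ P) (x : Site d) : cmod P x ∈ periodBox (d := d) P :=
  (mem_periodBox).2 fun κ => ⟨cmod_nonneg hP x κ, cmod_lt hP x κ⟩

omit [Fintype n] [DecidableEq n] in
/-- On the period box `cmod` is the identity. [folklore] -/
theorem cmod_eq_self_of_mem {P : ℕ} {x : Site d} (hx : x ∈ periodBox (d := d) P) : cmod P x = x := by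
  have h := (mem_periodBox).1 hx
  exact cmod_eq_of_repr (L := P) (z := 0) (by simp) (fun i => (h i).1) (fun i => (h i).2)

omit [Fintype n] [DecidableEq n] in
/-- `cmod` is invariant under period-lattice shifts: `cmod P (x + P•k) = cmod P x`. [folklore] -/
theorem cmod_add_zsmul {P : ℕ} (hP : 1 ≤ P) (x k : Site d) : cmod P (x + (P : ℤ) • k) = cmod P x := by
  refine cmod_eq_of_repr (L := P) (z := cdiv P x + k) ?_ (fun i => cmod_nonneg hP x i) (fun i => cmod_lt hP x i)
  have h := smul_cdiv_add_cmod P x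
  conv_lhs => rw [← h]
  rw [smul_add]
  abel

omit [Fintype n] [DecidableEq n] in
/-- A `P`-periodic function takes the same value at `x` and at `cmod P x`. [folklore] -/
theorem apply_cmod_of_periodic {α : Type*} {P : ℕ} {f : Site d → α} (hf : ∀ (x : Site d) (κ : Fin d), f (x + (P : ℤ) • e κ) = f x)
    (x : Site d) : f (cmod P x) = f x := by
  have hx : x = cmod P x + (P : ℤ) • cdiv P x := by rw [add_comm, smul_cdiv_add_cmod]
  have h := periodic_smul_vec hf (cmod P x) (cdiv P x)
  rw [← hx] at h
  exact h.symm

omit [Fintype n] [DecidableEq n] in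
/-- `cmod P (cmod P x + w) = cmod P (x + w)`. [folklore] -/
theorem cmod_cmod_add {P : ℕ} (hP : 1 ≤ P) (x w : Site d) : cmod P (cmod P x + w) = cmod P (x + w) := by
  have h := smul_cdiv_add_cmod P x
  have hc : cmod P x = x - (P : ℤ) • cdiv P x := eq_sub_of_add_eq' h
  have e1 : cmod P x + w = (x + w) + (P : ℤ) • (-cdiv P x) := by
    rw [hc, smul_neg]; abel
  rw [e1, cmod_add_zsmul hP]

omit [Fintype n] [DecidableEq n] in
/-- **SHIFT INVARIANCE OF PERIODIC SUMS OVER THE PERIOD BOX** (vector-valued): `Σ_{x ∈ periodBox P} g(x + v) = Σ_{x ∈ periodBox P} g(x)`. [folklore] -/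
theorem sum_periodBox_shift_vec {E : Type*} [AddCommMonoid E] {P : ℕ} (hP : 1 ≤ P) {g : Site d → E}
    (hg : ∀ (x : Site d) (κ : Fin d), g (x + (P : ℤ) • e κ) = g x) (v : Site d) :
    ∑ x ∈ periodBox (d := d) P, g (x + v) = ∑ x ∈ periodBox (d := d) P, g x := by
  refine Finset.sum_bij' (fun x _ => cmod P (x + v)) (fun y _ => cmod P (y - v)) (fun x _ => cmod_mem_periodBox hP _)
    (fun y _ => cmod_mem_periodBox hP _) ?_ ?_ ?_
  · intro x hx
    rw [sub_eq_add_neg, cmod_cmod_add hP, ← sub_eq_add_neg, add_sub_cancel_right, cmod_eq_self_of_mem hx]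
  · intro y hy
    rw [cmod_cmod_add hP, sub_add_cancel, cmod_eq_self_of_mem hy]
  · intro x _
    exact (apply_cmod_of_periodic hg (x + v)).symm

/-! ## §2 The trace link functional attains its minimum over `{unitary, periodic, u 0 = 1}` -/

/-- **THE TRACE LINK FUNCTIONAL ATTAINS ITS MINIMUM** over the unitary `P`-periodic gauges with `u 0 = 1` (every `d`, `P ≥ 1`, `U`): there is such a `u`
with `Σ_{x ∈ periodBox P} Σ_κ (1 − Re tr U^{u}(x,κ)) ≤` the same for every competitor `v` of the class — compactness of the constraint set in the
finite-dimensional torus sections (the OWNER's N3a scheme, for the DIFFERENTIABLE trace functional and ONE-POINT normalisation). [folklore] -/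
theorem exists_traceLinkMinimiser [Nonempty n] (P : ℕ) [NeZero P] (U : Site d → Fin d → (Matrix n n ℂ)ˣ) :
    ∃ u : Site d → (Matrix n n ℂ)ˣ, (∀ x, u x ∈ unitaryUnits (Matrix n n ℂ)) ∧ (∀ (x : Site d) (τ : Fin d), u (x + (P : ℤ) • e τ) = u x) ∧
      u 0 = 1 ∧
      ∀ v : Site d → (Matrix n n ℂ)ˣ, (∀ x, v x ∈ unitaryUnits (Matrix n n ℂ)) → (∀ (x : Site d) (τ : Fin d), v (x + (P : ℤ) • e τ) = v x) →
        v 0 = 1 →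
        ∑ x ∈ periodBox (d := d) P, ∑ κ : Fin d, (1 - nReTr ((gaugeAct u U x κ : (Matrix n n ℂ)ˣ) : Matrix n n ℂ))
          ≤ ∑ x ∈ periodBox (d := d) P, ∑ κ : Fin d, (1 - nReTr ((gaugeAct v U x κ : (Matrix n n ℂ)ˣ) : Matrix n n ℂ)) := by
  letI : CStarAlgebra (Matrix n n ℂ) := {}
  -- the functional on torus sections, written without inverses (`u(x+e_κ)⁻¹ = u(x+e_κ)⋆` on the constraint set)
  let Φ : Sec d n P → ℝ := fun a =>
    ∑ x ∈ periodBox (d := d) P, ∑ κ : Fin d, (1 - nReTr (extS P a x * ((U x κ : (Matrix n n ℂ)ˣ) : Matrix n n ℂ) * star (extS P a (x + e κ))))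
  have hΦ : Continuous Φ := by
    refine continuous_finsetSum _ fun x _ => continuous_finsetSum _ fun κ _ => continuous_const.sub ?_
    exact continuous_nReTr.comp (((continuous_extS_apply P x).mul continuous_const).mul (continuous_extS_apply P (x + e κ)).star)
  -- the constraint set: unitary values, value `1` on the residue class of `0`
  let K : Set (Sec d n P) := {a | ∀ x : Site d, extS P a x ∈ unitary (Matrix n n ℂ) ∧ ((∃ y : Site d, x = (P : ℤ) • y) → extS P a x = 1)}
  have hKclosed : IsClosed K := by
    have hK : K = ⋂ x : Site d, ({a : Sec d n P | extS P a x ∈ unitary (Matrix n n ℂ)} ∩ {a | (∃ y : Site d, x = (P : ℤ) • y) → extS P a x = 1}) := by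
      ext a; simp only [K, Set.mem_setOf_eq, Set.mem_iInter, Set.mem_inter_iff]
    rw [hK]
    refine isClosed_iInter fun x => IsClosed.inter (isClosed_unitary.preimage (continuous_extS_apply P x)) ?_
    by_cases hx : ∃ y : Site d, x = (P : ℤ) • y
    · have : {a : Sec d n P | (∃ y : Site d, x = (P : ℤ) • y) → extS P a x = 1} = {a | extS P a x = 1} := by
        ext a; simp only [Set.mem_setOf_eq]; exact ⟨fun h => h hx, fun h _ => h⟩
      rw [this]; exact isClosed_eq (continuous_extS_apply P x) continuous_const
    · have : {a : Sec d n P | (∃ y : Site d, x = (P : ℤ) • y) → extS P a x = 1} = Set.univ := by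
        ext a; simp only [Set.mem_setOf_eq, Set.mem_univ, iff_true]; exact fun h => absurd h hx
      rw [this]; exact isClosed_univ
  have hKbdd : Bornology.IsBounded K := by
    rw [isBounded_iff_forall_norm_le]
    refine ⟨Real.sqrt (Fintype.card (Fin d → Fin P)), fun a ha => ?_⟩
    rw [PiLp.norm_eq_of_L2]
    refine Real.sqrt_le_sqrt ?_
    calc ∑ s : Fin d → Fin P, ‖a s‖ ^ 2 ≤ ∑ _s : Fin d → Fin P, (1 : ℝ) := Finset.sum_le_sum fun s _ => by
            have h := (ha (boxVec P s)).1
            rw [extS_boxVec] at h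
            exact norm_sq_le_one_of_unitary h
      _ = Fintype.card (Fin d → Fin P) := by rw [Finset.sum_const, Finset.card_univ, nsmul_eq_mul, mul_one]
  have hKc : IsCompact K := Metric.isCompact_of_isClosed_isBounded hKclosed hKbdd
  have hK1 : (resS P (fun _ : Site d => (1 : Matrix n n ℂ))) ∈ K := by
    have h1 : extS P (resS P (fun _ : Site d => (1 : Matrix n n ℂ))) = fun _ => 1 := extS_resS P (fun _ _ => rfl)
    intro x
    rw [h1]
    exact ⟨(unitary (Matrix n n ℂ)).one_mem, fun _ => rfl⟩
  obtain ⟨a₀, ha₀K, hmin⟩ := hKc.exists_isMinOn ⟨_, hK1⟩ hΦ.continuousOn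
  let u : Site d → (Matrix n n ℂ)ˣ := fun x =>
    ⟨extS P a₀ x, star (extS P a₀ x), Unitary.mul_star_self_of_mem (ha₀K x).1, Unitary.star_mul_self_of_mem (ha₀K x).1⟩
  have hu_val : ∀ x, ((u x : (Matrix n n ℂ)ˣ) : Matrix n n ℂ) = extS P a₀ x := fun _ => rfl
  have hu_inv : ∀ x, (((u x)⁻¹ : (Matrix n n ℂ)ˣ) : Matrix n n ℂ) = star (extS P a₀ x) := fun _ => rfl
  refine ⟨u, fun x => mem_unitaryUnits.mpr (ha₀K x).1, fun x τ => Units.ext ?_, Units.ext ?_, fun v hvu hvP hv0 => ?_⟩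
  · rw [hu_val, hu_val, extS_add_period]
  · rw [hu_val, Units.val_one]; exact (ha₀K 0).2 ⟨0, by simp⟩
  have hvext : extS P (resS P (fun x => ((v x : (Matrix n n ℂ)ˣ) : Matrix n n ℂ))) = fun x => ((v x : (Matrix n n ℂ)ˣ) : Matrix n n ℂ) :=
    extS_resS P (fun x τ => by rw [hvP x τ])
  have hvK : resS P (fun x => ((v x : (Matrix n n ℂ)ˣ) : Matrix n n ℂ)) ∈ K := by
    intro x
    rw [hvext]
    refine ⟨mem_unitaryUnits.mp (hvu x), fun ⟨y, hy⟩ => ?_⟩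
    subst hy
    have hper : v ((P : ℤ) • y) = v 0 := by
      have h := periodic_smul_vec (f := v) (N := (P : ℤ)) hvP 0 y
      rw [zero_add] at h; exact h
    dsimp only; rw [hper, hv0, Units.val_one]
  have hle := hmin hvK
  have hΦu : Φ a₀ = ∑ x ∈ periodBox (d := d) P, ∑ κ : Fin d, (1 - nReTr ((gaugeAct u U x κ : (Matrix n n ℂ)ˣ) : Matrix n n ℂ)) := by
    refine Finset.sum_congr rfl fun x _ => Finset.sum_congr rfl fun κ _ => ?_
    rw [show ((gaugeAct u U x κ : (Matrix n n ℂ)ˣ) : Matrix n n ℂ) = extS P a₀ x * ((U x κ : (Matrix n n ℂ)ˣ) : Matrix n n ℂ) * star (extS P a₀ (x + e κ)) by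
      unfold gaugeAct; rw [Units.val_mul, Units.val_mul, hu_val, hu_inv]]
  have hΦv : Φ (resS P (fun x => ((v x : (Matrix n n ℂ)ˣ) : Matrix n n ℂ)))
      = ∑ x ∈ periodBox (d := d) P, ∑ κ : Fin d, (1 - nReTr ((gaugeAct v U x κ : (Matrix n n ℂ)ˣ) : Matrix n n ℂ)) := by
    refine Finset.sum_congr rfl fun x _ => Finset.sum_congr rfl fun κ _ => ?_
    rw [hvext]
    rw [show ((gaugeAct v U x κ : (Matrix n n ℂ)ˣ) : Matrix n n ℂ)
        = ((v x : (Matrix n n ℂ)ˣ) : Matrix n n ℂ) * ((U x κ : (Matrix n n ℂ)ˣ) : Matrix n n ℂ) * star ((v (x + e κ) : (Matrix n n ℂ)ˣ) : Matrix n n ℂ) by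
      unfold gaugeAct; rw [Units.val_mul, Units.val_mul, AveragingDeficitTransport.val_inv_eq_star_of_unitary (hvu _)]]
  rw [← hΦu, ← hΦv]
  exact hle

end

end Summit.QuantumFields.BalabanUV.T4Continuum.NE7LatticeLandauMinimiser
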